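import Mathlib
import HarnessLib
import Literature.Computability.AlgebraicComplexity.SymmetricArithCircuit
import Literature.Computability.AlgebraicComplexity.DawarWilsenach2025Proofs
import Literature.Computability.AlgebraicComplexity.MonotoneStructure
import Summits.ValiantsHypothesis.ValiantsHypothesis.Theorems.MonotoneRestorationMonotoneRestorationQPMulGateChildren
import Summits.ValiantsHypothesis.ValiantsHypothesis.Theorems.MonotoneRestorationMonotoneRestorationQPRowShadow

/-!
# ValiantsHypothesis / MonotoneRestoration — `MonotoneRestorationQP`, line `Sketch`: the monotone spine

Support file for crux item `stmt-ValiantsHypothesis-15886`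
(`Summit.ValiantsHypothesis.ValiantsHypothesis.Theses.MonotoneRestoration.MonotoneRestorationQP`),
line `Sketch`, Theorem γ, stub G6 `stub_symmetricMonotone_choose_le_card` (invested seat xfam-a,
direct attempt A): the two local lemmas of the SPINE ARGUMENT for symmetric circuits over the
semiring `ℝ≥0` (Dawar–Wilsenach `LabelledArithCircuit`, unbounded fan-in, `IsSymmetric` under
the diagonal action of `Sym_n` on the matrix of variables).

Setting. `f = C.eval (C.output ())` is homogeneous of degree `d` and ROW-MULTILINEAR (every
monomial has degree `≤ 1` in every row). A *spine state* at a gate `g` is a monomial `m` of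
`C.eval g` together with a *context* monomial `e` such that EVERY monomial of `C.eval g` shifted
by `e` is a monomial of `f` (over `ℝ≥0` nothing cancels, so this propagates from a gate to its
children: `stub_mulGate_children_extend`). A gate `g` is *guarded by `X`* if every even
permutation fixing `X` pointwise extends to a circuit automorphism fixing `g` (the conclusion of
the support theorem `stub_gateSupport`, `|X| < k`).

* `spine_degree_dichotomy` — at a gate guarded by `X`, `|X| < k`, a spine state has
  `deg m < k` or `deg m > d - k`: the row shadow of `C.eval g` is stable under the even
  permutations fixing `X`, hence (`rowSet_trichotomy`) inside `X` (so `deg m < k`), or of size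
  `≤ 1`, or it contains `Xᶜ` — and then the context `e`, whose rows avoid every row of
  `C.eval g`, lives on `X`, so `deg e < k`.
* `mulGate_spine_step` — at a MULTIPLICATION gate guarded by `X` with a spine state of degree
  `≥ k`, some child carries a spine state of degree `≥ deg m - |X|`: the automorphisms fixing `g`
  permute its children, distinct children have disjoint row shadows (row-multilinearity, G3), so
  by `rowSet_trichotomy` every child's row shadow lies inside `X` ("small"), contains `Xᶜ`
  ("big"), or is a single row outside `X` — the last is impossible because the `3`-cycles then
  produce `|Xᶜ| > d` children with pairwise different single rows and hence a monomial of degree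
  `> d` (`mulGate_no_singleton_child`); two big children would share the rows of `Xᶜ`; and the
  small children together contribute degree `≤ |X|` to `m`, so the big child exists and receives
  the rest. NO bound on the fan-in and NO invariance of the individual children is needed.
-/

-- `Summit.ValiantsHypothesis.ValiantsHypothesis.…` is the tree's mandated single-conjunct layout
-- (Sub = Summit), so the duplicated namespace component is intended.
set_option linter.dupNamespace false

noncomputable section

namespace Summit.ValiantsHypothesis.ValiantsHypothesis.Theorems

open Literature.Computability.AlgebraicComplexity MvPolynomial Finset
open scoped NNReal

variable {n : ℕ} {G : Type}

/-! ### Spine states -/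

/-- In a spine state every monomial of the gate and the context have disjoint rows (row degrees
add up to at most `1`). [folklore] -/
theorem spine_rowDegrees_add_le (C : LabelledArithCircuit ℝ≥0 (Fin n × Fin n) Unit G)
    (hrow : ∀ m ∈ (C.eval (C.output ())).support, ∀ i : Fin n, rowDegrees m i ≤ 1)
    {g : G} {e : Fin n × Fin n →₀ ℕ}
    (he : ∀ m' ∈ (C.eval g).support, m' + e ∈ (C.eval (C.output ())).support)
    {m' : Fin n × Fin n →₀ ℕ} (hm' : m' ∈ (C.eval g).support) (i : Fin n) :
    rowDegrees m' i + rowDegrees e i ≤ 1 := by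
  have := hrow _ (he m' hm') i
  rwa [rowDegrees_add, Finsupp.add_apply] at this

/-- In a spine state every monomial of the gate has degree `d - deg e`. [folklore] -/
theorem spine_degree_add_eq (C : LabelledArithCircuit ℝ≥0 (Fin n × Fin n) Unit G) {d : ℕ}
    (hhom : (C.eval (C.output ())).IsHomogeneous d)
    {g : G} {e : Fin n × Fin n →₀ ℕ}
    (he : ∀ m' ∈ (C.eval g).support, m' + e ∈ (C.eval (C.output ())).support)
    {m' : Fin n × Fin n →₀ ℕ} (hm' : m' ∈ (C.eval g).support) :
    m'.degree + e.degree = d := by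
  have h := hhom.degree_eq_sum_deg_support (he m' hm')
  rw [← Finsupp.degree_apply, map_add] at h
  exact h.symm

/-- An automorphism fixing a gate permutes its children. [cite: DawarWilsenach2025, Def. 3.6] -/
theorem children_perm_of_apply_eq {K X Y : Type*} {Γ : Type*} [Group Γ] [MulAction Γ X]
    [MulAction Γ Y] (C : LabelledArithCircuit K X Y G) {γ : Γ} {π : Equiv.Perm G}
    (hπ : C.IsAutomorphismExtending γ π) {g : G} (hg : π g = g) {h : G} (hh : h ∈ C.children g) :
    π h ∈ C.children g := by
  have hc := hπ.children_apply g
  rw [hg] at hc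
  rw [hc]
  exact mem_map_of_mem _ hh

/-- **Degree dichotomy on the spine.** At a gate `g` guarded by `X` (`|X| < k`, `|X| + 3 ≤ n`) a
spine state `(m, e)` has `deg m < k` or `deg m + k > d`. [folklore] -/
theorem spine_degree_dichotomy (C : LabelledArithCircuit ℝ≥0 (Fin n × Fin n) Unit G) {d k : ℕ}
    (hhom : (C.eval (C.output ())).IsHomogeneous d)
    (hrow : ∀ m ∈ (C.eval (C.output ())).support, ∀ i : Fin n, rowDegrees m i ≤ 1)
    (hk : 2 ≤ k) {g : G} (X : Finset (Fin n)) (hXk : X.card < k) (hX3 : X.card + 3 ≤ n)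
    (haut : ∀ ρ : Equiv.Perm (Fin n), (∀ x ∈ X, ρ x = x) → Equiv.Perm.sign ρ = 1 →
      ∃ π : Equiv.Perm G, C.IsAutomorphismExtending ρ π ∧ π g = g)
    {m e : Fin n × Fin n →₀ ℕ} (hm : m ∈ (C.eval g).support)
    (he : ∀ m' ∈ (C.eval g).support, m' + e ∈ (C.eval (C.output ())).support) :
    m.degree < k ∨ d < m.degree + k := by
  classical
  -- the value at `g` is invariant under the even permutations fixing `X`
  have hinv : ∀ ρ : Equiv.Perm (Fin n), (∀ x ∈ X, ρ x = x) → Equiv.Perm.sign ρ = 1 →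
      rename (fun x : Fin n × Fin n => ρ • x) (C.eval g) = C.eval g := by
    intro ρ hρ hs
    obtain ⟨π, hπ, hπg⟩ := haut ρ hρ hs
    have := hπ.eval_apply g
    rw [hπg] at this
    exact this.symm
  set R : Finset (Fin n) := (C.eval g).support.biUnion fun m => (rowDegrees m).support with hR
  have hstab : ∀ ρ : Equiv.Perm (Fin n), (∀ x ∈ X, ρ x = x) → Equiv.Perm.sign ρ = 1 →
      R.map ρ.toEmbedding = R := by
    intro ρ hρ hs
    rw [hR, ← rowShadow_rename, hinv ρ hρ hs]
  have hm1 : ∀ i, rowDegrees m i ≤ 1 := fun i => by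
    have := spine_rowDegrees_add_le C hrow he hm i
    omega
  have hmR : ∀ i, rowDegrees m i ≠ 0 → i ∈ R := fun i hi =>
    (mem_rowShadow_iff _ i).2 ⟨m, hm, hi⟩
  rcases rowSet_trichotomy X R hX3 (fun ρ hρ hs => Or.inl (hstab ρ hρ hs)) with h1 | h2 | ⟨h3, -⟩
  · -- rows inside `X`
    left
    exact lt_of_le_of_lt (degree_le_card_of_rowDegrees_le_one X hm1 fun i hi => h1 (hmR i hi)) hXk
  · -- rows contain `Xᶜ`: the context lives on `X`
    right
    have hdeg := spine_degree_add_eq C hhom he hm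
    have he1 : ∀ i, rowDegrees e i ≤ 1 := fun i => by
      have := spine_rowDegrees_add_le C hrow he hm i
      omega
    have heX : ∀ i, rowDegrees e i ≠ 0 → i ∈ X := by
      intro i hi
      by_contra hiX
      obtain ⟨m', hm', hi'⟩ := (mem_rowShadow_iff _ i).1 (h2 i hiX)
      have := spine_rowDegrees_add_le C hrow he hm' i
      omega
    have := degree_le_card_of_rowDegrees_le_one X he1 heX
    omega
  · -- at most one row: degree `≤ 1 < k`
    left
    have := degree_le_card_of_rowDegrees_le_one R hm1 hmR
    omega

/-! ### The step at a multiplication gate -/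

/-- Spine states propagate to the children of a multiplication gate: the new context is the old
one plus one monomial of every other child (no cancellation over `ℝ≥0`). [folklore] -/
theorem spine_mul_child [DecidableEq G] (C : LabelledArithCircuit ℝ≥0 (Fin n × Fin n) Unit G)
    {g : G} (hg : C.label g = .mul) {e : Fin n × Fin n →₀ ℕ}
    (he : ∀ m' ∈ (C.eval g).support, m' + e ∈ (C.eval (C.output ())).support)
    (μ : G → (Fin n × Fin n →₀ ℕ)) (hμ : ∀ x ∈ C.children g, μ x ∈ (C.eval x).support)
    {h : G} (hh : h ∈ C.children g) :
    ∀ m' ∈ (C.eval h).support,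
      m' + (e + ∑ x ∈ (C.children g).erase h, μ x) ∈ (C.eval (C.output ())).support := by
  intro m' hm'
  have hprod : C.eval g = C.eval h * ∏ x ∈ (C.children g).erase h, C.eval x := by
    rw [C.eval_of_label_mul hg, mul_prod_erase _ _ hh]
  have h1 : m' + ∑ x ∈ (C.children g).erase h, μ x ∈ (C.eval g).support := by
    rw [hprod]
    exact add_mem_support_mul hm'
      (sum_mem_support_prod _ _ _ fun x hx => hμ x (mem_of_mem_erase hx))
  have h2 := he _ h1
  rwa [add_assoc, add_comm (∑ x ∈ (C.children g).erase h, μ x) e] at h2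

/-- Distinct children of a multiplication gate carrying a spine state have disjoint row shadows
(row-multilinearity of `f` and `stub_mulGate_children_extend`). [folklore] -/
theorem mulGate_children_rows_disjoint (C : LabelledArithCircuit ℝ≥0 (Fin n × Fin n) Unit G)
    (hrow : ∀ m ∈ (C.eval (C.output ())).support, ∀ i : Fin n, rowDegrees m i ≤ 1)
    {g : G} (hg : C.label g = .mul) (h0 : C.eval g ≠ 0) {e : Fin n × Fin n →₀ ℕ}
    (he : ∀ m' ∈ (C.eval g).support, m' + e ∈ (C.eval (C.output ())).support)
    {h h' : G} (hh : h ∈ C.children g) (hh' : h' ∈ C.children g) (hne : h ≠ h') :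
    Disjoint ((C.eval h).support.biUnion fun m => (rowDegrees m).support)
      ((C.eval h').support.biUnion fun m => (rowDegrees m).support) := by
  rw [disjoint_left]
  intro i hi hi'
  obtain ⟨m₁, hm₁, hi₁⟩ := (mem_rowShadow_iff _ i).1 hi
  obtain ⟨m₂, hm₂, hi₂⟩ := (mem_rowShadow_iff _ i).1 hi'
  obtain ⟨μ, hμ⟩ :=
    (stub_mulGate_children_extend C (C.eval (C.output ())) hg h0 ⟨e, he⟩).2 h hh h' hh' hne
      m₁ hm₁ m₂ hm₂
  have := hrow _ hμ i
  simp only [rowDegrees_add, Finsupp.add_apply] at this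
  omega

/-- **No singleton child.** At a multiplication gate guarded by `X` (`|X| < k`, `|X| + 3 ≤ n`,
`d + k ≤ n`) carrying a spine state, no child has a row shadow consisting of a single row outside
`X`: the `3`-cycles through that row give, for every row outside `X`, a child with exactly that
row shadow, hence a monomial of `C.eval g` of degree `≥ n - |X| > d`. [folklore] -/
theorem mulGate_no_singleton_child (C : LabelledArithCircuit ℝ≥0 (Fin n × Fin n) Unit G)
    {d k : ℕ} (hhom : (C.eval (C.output ())).IsHomogeneous d)
    {g : G} (hg : C.label g = .mul) (h0 : C.eval g ≠ 0) (X : Finset (Fin n)) (hXk : X.card < k)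
    (hX3 : X.card + 3 ≤ n) (hdk : d + k ≤ n)
    (haut : ∀ ρ : Equiv.Perm (Fin n), (∀ x ∈ X, ρ x = x) → Equiv.Perm.sign ρ = 1 →
      ∃ π : Equiv.Perm G, C.IsAutomorphismExtending ρ π ∧ π g = g)
    {e : Fin n × Fin n →₀ ℕ}
    (he : ∀ m' ∈ (C.eval g).support, m' + e ∈ (C.eval (C.output ())).support)
    {h₀ : G} (hh₀ : h₀ ∈ C.children g) {a : Fin n} (haX : a ∉ X)
    (hra : ((C.eval h₀).support.biUnion fun m => (rowDegrees m).support) = {a}) : False := by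
  classical
  -- for every row `ω` outside `X` a child whose row shadow is `{ω}`
  have key : ∀ ω : Fin n, ω ∉ X → ∃ h ∈ C.children g,
      ((C.eval h).support.biUnion fun m => (rowDegrees m).support) = {ω} := by
    intro ω hω
    by_cases hωa : ω = a
    · exact ⟨h₀, hh₀, hωa ▸ hra⟩
    obtain ⟨c, hcX, hca, hcω⟩ := exists_not_mem_ne_ne X hX3 a ω
    obtain ⟨ρ, hρX, hρs, hρa, -, -, -⟩ :=
      exists_threeCycle_fixing X haX hω hcX (Ne.symm hωa) (Ne.symm hcω) (Ne.symm hca)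
    obtain ⟨π, hπ, hπg⟩ := haut ρ hρX hρs
    refine ⟨π h₀, children_perm_of_apply_eq C hπ hπg hh₀, ?_⟩
    rw [hπ.eval_apply, rowShadow_rename, hra, map_singleton]
    simp [hρa]
  haveI : Nonempty G := ⟨g⟩
  choose! φ hφmem hφrows using key
  set Ω : Finset (Fin n) := univ.filter fun ω => ω ∉ X with hΩ
  have hΩcard : Ω.card = n - X.card := by
    have : Ω = univ \ X := by
      ext ω
      simp [hΩ]
    rw [this, card_univ_sdiff, Fintype.card_fin]
  have hinj : Set.InjOn φ (Ω : Set (Fin n)) := by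
    intro ω hω ω' hω' hφ
    have hω1 : ω ∉ X := (mem_filter.1 hω).2
    have hω2 : ω' ∉ X := (mem_filter.1 hω').2
    have := hφrows ω hω1
    rw [hφ, hφrows ω' hω2] at this
    exact (singleton_injective this).symm
  set T : Finset G := Ω.image φ with hT
  have hTsub : T ⊆ C.children g := by
    intro x hx
    obtain ⟨ω, hω, rfl⟩ := mem_image.1 hx
    exact hφmem ω (mem_filter.1 hω).2
  have hTcard : T.card = n - X.card := by rw [hT, card_image_of_injOn hinj, hΩcard]
  -- one monomial of every child, of degree `≥ 1` on `T`
  have hfac : ∀ x ∈ C.children g, C.eval x ≠ 0 := by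
    intro x hx hx0
    apply h0
    rw [C.eval_of_label_mul hg]
    exact prod_eq_zero hx hx0
  have hν : ∀ x ∈ C.children g, ∃ ν ∈ (C.eval x).support, x ∈ T → 1 ≤ ν.degree := by
    intro x hx
    by_cases hxT : x ∈ T
    · obtain ⟨ω, hω, rfl⟩ := mem_image.1 hxT
      have hω1 : ω ∉ X := (mem_filter.1 hω).2
      have hωr : ω ∈ (C.eval (φ ω)).support.biUnion fun m => (rowDegrees m).support := by
        rw [hφrows ω hω1]
        exact mem_singleton_self ω
      obtain ⟨ν, hν, hi⟩ := (mem_rowShadow_iff _ ω).1 hωr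
      exact ⟨ν, hν, fun _ => one_le_degree_of_rowDegrees_ne_zero hi⟩
    · obtain ⟨ν, hν⟩ := support_nonempty.2 (hfac x hx)
      exact ⟨ν, hν, fun h => absurd h hxT⟩
  choose! ν hνmem hνdeg using hν
  have hM : ∑ x ∈ C.children g, ν x ∈ (C.eval g).support := by
    rw [C.eval_of_label_mul hg]
    exact sum_mem_support_prod _ _ _ hνmem
  have hdegM := spine_degree_add_eq C hhom he hM
  have hle : T.card ≤ (∑ x ∈ C.children g, ν x).degree := by
    rw [map_sum]
    calc T.card = ∑ x ∈ T, 1 := by simp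
      _ ≤ ∑ x ∈ T, (ν x).degree := sum_le_sum fun x hx => hνdeg x (hTsub hx) hx
      _ ≤ ∑ x ∈ C.children g, (ν x).degree := sum_le_sum_of_subset hTsub
  omega

/-- **The spine step at a multiplication gate.** At a `×` gate guarded by `X` (`|X| < k`,
`|X| + 3 ≤ n`, `d + k ≤ n`) a spine state `(m, e)` with `deg m ≥ k` passes to some child `h`: a
spine state `(m', e')` at `h` with `deg m ≤ deg m' + |X|`. [folklore] -/
theorem mulGate_spine_step {n : ℕ} {G : Type} (C : LabelledArithCircuit NNReal (Fin n × Fin n) Unit G)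
    {d k : ℕ} (hhom : (C.eval (C.output ())).IsHomogeneous d)
    (hrow : ∀ m ∈ (C.eval (C.output ())).support, ∀ i : Fin n, rowDegrees m i ≤ 1)
    {g : G} (hg : C.label g = .mul) (X : Finset (Fin n)) (hXk : X.card < k)
    (hX3 : X.card + 3 ≤ n) (hdk : d + k ≤ n)
    (haut : ∀ ρ : Equiv.Perm (Fin n), (∀ x ∈ X, ρ x = x) → Equiv.Perm.sign ρ = 1 →
      ∃ π : Equiv.Perm G, C.IsAutomorphismExtending ρ π ∧ π g = g)
    {m e : Fin n × Fin n →₀ ℕ} (hm : m ∈ (C.eval g).support)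
    (he : ∀ m' ∈ (C.eval g).support, m' + e ∈ (C.eval (C.output ())).support)
    (hkm : k ≤ m.degree) :
    ∃ h ∈ C.children g, ∃ m' e' : Fin n × Fin n →₀ ℕ, m' ∈ (C.eval h).support ∧
      (∀ m'' ∈ (C.eval h).support, m'' + e' ∈ (C.eval (C.output ())).support) ∧
      m.degree ≤ m'.degree + X.card := by
  classical
  have h0 : C.eval g ≠ 0 := fun h0 => by simp [h0] at hm
  set s := C.children g with hs
  have hprod : C.eval g = ∏ x ∈ s, C.eval x := C.eval_of_label_mul hg
  obtain ⟨μ, hμ, hsum⟩ := exists_sum_of_mem_support_prod s (fun x => C.eval x) (hprod ▸ hm)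
  -- row shadows of the children
  set R : G → Finset (Fin n) := fun x => (C.eval x).support.biUnion fun m => (rowDegrees m).support
    with hR
  have hdisj : ∀ x ∈ s, ∀ y ∈ s, x ≠ y → Disjoint (R x) (R y) := fun x hx y hy hxy =>
    mulGate_children_rows_disjoint C hrow hg h0 he hx hy hxy
  -- the orbit dichotomy for every child
  have horb : ∀ x ∈ s, ∀ ρ : Equiv.Perm (Fin n), (∀ x ∈ X, ρ x = x) → Equiv.Perm.sign ρ = 1 →
      (R x).map ρ.toEmbedding = R x ∨ Disjoint ((R x).map ρ.toEmbedding) (R x) := by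
    intro x hx ρ hρ hsg
    obtain ⟨π, hπ, hπg⟩ := haut ρ hρ hsg
    have hπx : π x ∈ s := children_perm_of_apply_eq C hπ hπg hx
    have hRπ : R (π x) = (R x).map ρ.toEmbedding := by
      simp only [hR]
      rw [hπ.eval_apply, rowShadow_rename]
    by_cases hfix : π x = x
    · left
      rw [← hRπ, hfix]
    · right
      rw [← hRπ]
      exact hdisj _ hπx _ hx hfix
  -- every child is small (`R x ⊆ X`) or big (`Xᶜ ⊆ R x`)
  have hclass : ∀ x ∈ s, R x ⊆ X ∨ ∀ i, i ∉ X → i ∈ R x := by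
    intro x hx
    rcases rowSet_trichotomy X (R x) hX3 (horb x hx) with h1 | h2 | ⟨h3, h4⟩
    · exact Or.inl h1
    · exact Or.inr h2
    · rcases Nat.lt_or_ge (R x).card 1 with h5 | h5
      · left
        have : R x = ∅ := card_eq_zero.1 (by omega)
        rw [this]
        exact empty_subset X
      · exfalso
        obtain ⟨a, ha⟩ := card_eq_one.1 (le_antisymm h3 h5)
        have haX : a ∉ X := disjoint_left.1 h4 (by rw [ha]; exact mem_singleton_self a)
        exact mulGate_no_singleton_child C hhom hg h0 X hXk hX3 hdk haut he hx haX ha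
  -- rows of the parts
  have hμR : ∀ x ∈ s, ∀ i, rowDegrees (μ x) i ≠ 0 → i ∈ R x := fun x hx i hi =>
    (mem_rowShadow_iff _ i).2 ⟨μ x, hμ x hx, hi⟩
  have hm1 : ∀ i, rowDegrees m i ≤ 1 := fun i => by
    have := spine_rowDegrees_add_le C hrow he hm i
    omega
  -- a big child exists (otherwise `deg m ≤ |X| < k`)
  have hbig : ∃ B ∈ s, ∀ i, i ∉ X → i ∈ R B := by
    by_contra hno
    push Not at hno
    have hsmall : ∀ x ∈ s, R x ⊆ X := by
      intro x hx
      refine (hclass x hx).resolve_right fun hbig => ?_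
      obtain ⟨i, hi, hi'⟩ := hno x hx
      exact hi' (hbig i hi)
    have hmX : ∀ i, rowDegrees m i ≠ 0 → i ∈ X := by
      intro i hi
      rw [← hsum, rowDegrees_sum, Finsupp.finsetSum_apply] at hi
      obtain ⟨x, hx, hx0⟩ := exists_ne_zero_of_sum_ne_zero hi
      exact hsmall x hx (hμR x hx i hx0)
    have := degree_le_card_of_rowDegrees_le_one X hm1 hmX
    omega
  obtain ⟨B, hB, hBbig⟩ := hbig
  -- every other child is small
  have hothers : ∀ x ∈ s, x ≠ B → R x ⊆ X := by
    intro x hx hxB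
    refine (hclass x hx).resolve_right fun hxbig => ?_
    obtain ⟨i, hiX, -, -⟩ := exists_not_mem_ne_ne X hX3 (⟨0, by omega⟩ : Fin n) ⟨0, by omega⟩
    exact disjoint_left.1 (hdisj x hx B hB hxB) (hxbig i hiX) (hBbig i hiX)
  refine ⟨B, hB, μ B, e + ∑ x ∈ s.erase B, μ x, hμ B hB, spine_mul_child C hg he μ hμ hB, ?_⟩
  -- degree bookkeeping: the other parts live on `X`
  have hsplit : m = μ B + ∑ x ∈ s.erase B, μ x := by rw [← hsum, add_sum_erase _ _ hB]
  have hν1 : ∀ i, rowDegrees (∑ x ∈ s.erase B, μ x) i ≤ 1 := by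
    intro i
    have := hm1 i
    rw [hsplit, rowDegrees_add, Finsupp.add_apply] at this
    omega
  have hνX : ∀ i, rowDegrees (∑ x ∈ s.erase B, μ x) i ≠ 0 → i ∈ X := by
    intro i hi
    rw [rowDegrees_sum, Finsupp.finsetSum_apply] at hi
    obtain ⟨x, hx, hx0⟩ := exists_ne_zero_of_sum_ne_zero hi
    have hxs : x ∈ s := mem_of_mem_erase hx
    exact hothers x hxs (ne_of_mem_erase hx) (hμR x hxs i hx0)
  have hν := degree_le_card_of_rowDegrees_le_one X hν1 hνX
  calc m.degree = (μ B).degree + (∑ x ∈ s.erase B, μ x).degree := by rw [hsplit, map_add]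
    _ ≤ (μ B).degree + X.card := by omega

end Summit.ValiantsHypothesis.ValiantsHypothesis.Theorems

end
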